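import Mathlib
import HarnessLib
import Literature.MathematicalPhysics.StatisticalMechanics.RenormalisationMap
import Literature.MathematicalPhysics.StatisticalMechanics.FluctuationOfHamiltonian
import Literature.MathematicalPhysics.StatisticalMechanics.InitialPolymerActivity

/-!
# The origin is a fixed point of the renormalisation map: `T_k(0, 𝟙_∅) = (0, 𝟙_∅)`
# ([ABKM19] Definition 6.5: `S_k(0,0) = 0`, the hypothesis `map_zero` of the fine tuning)

With the zero relevant Hamiltonian `H = 0` and the trivial activity `K = 𝟙_∅` (`punit`: `1` at the
empty polymer, `0` elsewhere — the zero vector of `M(𝓟_k^c)` extended multiplicatively), the step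
(6.15)–(6.16)/(6.34) returns `H_{k+1} = 0` and `K_{k+1} = 𝟙_∅`: `e^{−H} = 1`, `H̃ = Π₂R(0) − Π₂R(0) = 0`,
`Φ(X) = 𝟙_∅(X)`, and only `X = ∅` reblocks to `∅`.  This is the hypothesis `S_k(0,0) = 0` of the
fine-tuning theorem ([ABKM19] Ch. 12; the tree's `RGFlow.IsRGStepQ.map_zero`).

* `trivAct` — the trivial activity `𝟙_∅` as a (field-independent) polymer functional;
* `fluct_const`, `Pi2_const_zero`, `nextH_zero_trivAct` (`H_{k+1} = 0`);
* `bprod_zero_eq_punit`, `midK_one_one_trivAct`, **`nextKStep_zero_trivAct`** (`K_{k+1}(U) = 𝟙_∅(U)`),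
  `rgStep_zero_trivAct`.

Everything is proved; no named fact.

## References
* S. Adams, S. Buchholz, R. Kotecký, S. Müller, arXiv:1910.13564, Definition 6.5, (6.32)–(6.34),
  Ch. 12 (the origin as fixed point) [AdamsBuchholzKoteckyMuller2019].
-/

noncomputable section

namespace Literature.MathematicalPhysics.StatisticalMechanics.GradientRG

open scoped BigOperators Classical
open Finset MeasureTheory
open Literature.MathematicalPhysics.StatisticalMechanics.TorusPolymer
  (IsPolymer blocks polys pcirc bprod punit reblock mem_polys blocks_empty punit_pcirc
    reblock_eq_empty_iff empty_mem_polys)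

variable {d M : ℕ} [NeZero M]

/-- **The trivial activity `𝟙_∅`** as a polymer functional (independent of the field): `1` at the
empty polymer, `0` elsewhere — the zero of `M(𝓟_k^c)` extended multiplicatively, the `K`-coordinate
of the origin of the flow. [cite: AdamsBuchholzKoteckyMuller2019, Ch. 6.2 (the unit 𝟙_∅)] -/
def trivAct : Finset (Fin d → ZMod M) → ((Fin d → ZMod M) → ℝ) → ℂ := fun X _ => punit X

omit [NeZero M] in
/-- `𝟙_∅(X, φ) = punit X`. [cite: AdamsBuchholzKoteckyMuller2019, Ch. 6.2] -/
@[simp] theorem trivAct_apply (X : Finset (Fin d → ZMod M)) (φ : (Fin d → ZMod M) → ℝ) :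
    trivAct X φ = punit X := rfl

/-! ## `H = 0`: `e^{−H} = 1`, `H̃ = 0` -/

/-- The fluctuation integral of a constant is the constant (`μ_{k+1}` is a probability measure).
[cite: AdamsBuchholzKoteckyMuller2019, Ch. 6.1 (6.9)] -/
theorem fluct_const (𝒞 : (Fin d → ZMod M) → ℝ) (c : ℂ) :
    fluct 𝒞 (fun _ => c) = fun _ => c := by
  haveI := isProbabilityMeasure_stepMeasure 𝒞
  funext φ
  simp [fluct]

/-- `Π₂` of the zero functional is `0`. [cite: AdamsBuchholzKoteckyMuller2019, Definition 8.6] -/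
theorem Pi2_const_zero (c : Fin d → ZMod M) (B : Finset (Fin d → ZMod M)) :
    Pi2 c B (fun _ : (Fin d → ZMod M) → ℝ => (0 : ℂ)) = 0 := by
  unfold Pi2
  rw [iteratedFDeriv_const_of_ne (by norm_num), fderiv_const_apply]
  funext ι
  rcases ι with u | α | q <;> simp

/-- **`H̃ = 0` at the origin**: `nextH D 0 𝟙_∅ = 0` (the reference block is non-empty, so
`𝟙_∅(B₀) = 0`). [cite: AdamsBuchholzKoteckyMuller2019, Definition 6.5 (6.15)–(6.16)] -/
theorem nextH_zero_trivAct (D : StepData d M) (hB : D.B₀ ≠ ∅) :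
    nextH D (0 : RelevantHamiltonian ℂ d) trivAct = 0 := by
  unfold nextH
  have h1 : eval (0 : RelevantHamiltonian ℂ d) D.B₀ = fun _ => (0 : ℂ) := funext fun φ => eval_zero _ _
  have h2 : (trivAct D.B₀ : ((Fin d → ZMod M) → ℝ) → ℂ) = fun _ => (0 : ℂ) := by
    funext φ; simp [punit, hB]
  rw [h1, h2, fluct_const, Pi2_const_zero, sub_self]

/-! ## `K = 𝟙_∅`: `Φ = 𝟙_∅`, `K_{k+1} = 𝟙_∅` -/

/-- The block product of the zero function is `𝟙_∅` on polymers (an empty product is `1`, a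
non-empty polymer has a block). [cite: AdamsBuchholzKoteckyMuller2019, Ch. 6.2 (6.19)] -/
theorem bprod_zero_eq_punit {s : ℕ} {X : Finset (Fin d → ZMod M)} :
    bprod s (fun _ => (0 : ℂ)) X = punit X := by
  unfold bprod punit
  by_cases hX : X = ∅
  · simp [hX]
  · rw [if_neg hX]
    obtain ⟨x, hx⟩ := Finset.nonempty_iff_ne_empty.2 hX
    exact Finset.prod_eq_zero (TorusPolymer.mem_blocks.2 ⟨x, hx, rfl⟩) rfl

/-- **`Φ = 𝟙_∅` at the origin**: with `I = Ĩ = 1` and `K = 𝟙_∅`, `midK s 1 1 𝟙_∅ X φ ξ = 𝟙_∅(X)`.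
[cite: AdamsBuchholzKoteckyMuller2019, Definition 6.5 (6.32)] -/
theorem midK_one_one_trivAct (s : ℕ) (X : Finset (Fin d → ZMod M)) (φ ξ : (Fin d → ZMod M) → ℝ) :
    midK s (fun _ _ => (1 : ℂ)) (fun _ _ => (1 : ℂ)) trivAct X φ ξ = punit X := by
  unfold midK
  have h0 : (fun B : Finset (Fin d → ZMod M) => (1 : ℂ) - 1) = fun _ => 0 := funext fun _ => sub_self _
  have h1 : (bprod s fun B : Finset (Fin d → ZMod M) => (1 : ℂ) - 1) = punit := by
    funext Y; rw [h0]; exact bprod_zero_eq_punit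
  have h2 : (fun Y => trivAct Y (φ + ξ)) = (punit : Finset (Fin d → ZMod M) → ℂ) :=
    funext fun Y => trivAct_apply Y _
  rw [h1, h2, punit_pcirc, punit_pcirc]

/-- **`K_{k+1} = 𝟙_∅` at the origin**: `nextKStep D 0 𝟙_∅ U φ = 𝟙_∅(U)` for every `U` (reference
block non-empty). [cite: AdamsBuchholzKoteckyMuller2019, Definition 6.5 (6.34)] -/
theorem nextKStep_zero_trivAct (D : StepData d M) (hB : D.B₀ ≠ ∅) (U : Finset (Fin d → ZMod M))
    (φ : (Fin d → ZMod M) → ℝ) :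
    nextKStep D (0 : RelevantHamiltonian ℂ d) trivAct U φ = punit U := by
  haveI := isProbabilityMeasure_stepMeasure D.𝒞
  unfold nextKStep nextK
  rw [nextH_zero_trivAct D hB]
  have hI : (expNegH (0 : RelevantHamiltonian ℂ d) : Finset (Fin d → ZMod M) → ((Fin d → ZMod M) → ℝ) → ℂ)
      = fun _ _ => 1 := by funext B ψ; exact expNegH_zero B ψ
  rw [hI]
  simp only [midK_one_one_trivAct, TorusPolymer.bprod_one, inv_one, one_mul, integral_const,
    probReal_univ, one_smul]
  -- only `X = U = ∅` contributes
  by_cases hU : U = ∅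
  · subst hU
    have hfilter : (polys D.s (univ : Finset (Fin d → ZMod M))).filter
        (fun X => reblock D.s (D.L * D.s) X = ∅) = {∅} := by
      ext X
      rw [mem_filter, mem_singleton, reblock_eq_empty_iff]
      exact ⟨fun h => h.2, fun h => ⟨h ▸ empty_mem_polys D.s _, h⟩⟩
    rw [hfilter, sum_singleton]
  · rw [show (punit U : ℂ) = 0 by simp [punit, hU]]
    refine Finset.sum_eq_zero fun X hX => ?_
    have hXU := (mem_filter.1 hX).2
    have hXne : X ≠ ∅ := fun h => hU (by rw [← hXU, h]; exact (reblock_eq_empty_iff _ _ _).2 rfl)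
    simp [punit, hXne]

/-- **The origin is a fixed point of `T_k`**: `rgStep D (0, 𝟙_∅) = (0, 𝟙_∅)`.
[cite: AdamsBuchholzKoteckyMuller2019, Definition 6.5] -/
theorem rgStep_zero_trivAct (D : StepData d M) (hB : D.B₀ ≠ ∅) :
    rgStep D ((0 : RelevantHamiltonian ℂ d), trivAct) = (0, trivAct) := by
  unfold rgStep
  rw [nextH_zero_trivAct D hB]
  congr 1
  funext U φ
  rw [nextKStep_zero_trivAct D hB U φ, trivAct_apply]

end Literature.MathematicalPhysics.StatisticalMechanics.GradientRG

end
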